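import Summits.QuantumFields.BalabanUV.Beta.GAN24.WilsonSectorRowHolds
import Summits.QuantumFields.BalabanUV.Beta.GAN24.WilsonSectorUndressedRow
import Summits.QuantumFields.BalabanUV.Beta.GAN24.TaylorRowDWThree
import Summits.QuantumFields.BalabanUV.Beta.GAN24.StencilSlotSupRate

/-!
# `BalabanUV.Beta.GAN24.WilsonSectorRate` — binder row G-an2-4 / (CONV-C), the row owner's CONTACT-TERM ROUTE, **CT-4e part 3** (`gen19/CT4-DESIGN-v0.md` §0 ∕ §3;
# design decision D-g22-1, journal [GAN24P1-G22-ONLINE]): **hSdev FOR THE CUBIC-WILSON SECTOR OF THE RECURSIVE COMB FAMILY (E)** — the all-scales Cauchy letter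
# `∀ k j, LocStencil (unitS_{k+j}(wilsonSecAt_{k+j}) − unitS_k(wilsonSecAt_k)) (cS·θS^k) δS` at SOME `θS < 1`, from hS0 (the owner's `WilsonSectorRowHolds.exists_hS0_wilsonSec`,
# UNCONDITIONAL) and a ONE-STEP SUP-NORM RATE of the unit tables, by road S3's interpolation `StencilSlotSupRate.locStencilCauchy_of_uniform_supRate`; the sup rate is
# road S3's undressed Wilson difference row (`TaylorRowDWThree.rowDW_three`, leaf-15 ∕ the T-N1C team) read in `push₃` currency PLUS the contact-term rate of part 2
# (`ContactCauchyAssembly.exists_contact_supRate_of_atoms`), taken here as the HYPOTHESIS `hCT` of its exact ∃-shape so that this file lands independently.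

NOT IN PRINT; OUR PROOF ATTEMPT (of the route; THIS file is [folklore] bookkeeping: leaf-03 g52's `SrecWilsonSector.unitS_wilsonSecAt_succ_eq_push₃`, the owner's
`WilsonSectorUndressedRow.e3OfS_smul_eq_push₃`, `rowDW_three` BY NAME, the scalar identity `cE·(cE·Lc^8)^{k+1} = Lc^4·(Lc^(k+1))^8·(cE·Lc^{4k}) = Lc^4·Lc^{12(k+1)}` at the
pin `cE = Lc^4`, the steps `(1,0)` and `(2,1)` by the uniform letter, and road S3's interpolation).  HONEST FRAMING (cell contract, verbatim): «discharging `BetaPertH`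
makes Bałaban's UV stability UNCONDITIONAL — a real constructive-QFT result; it is NOT the continuum limit and NOT the Clay problem.»  HONEST DEPENDENCY (verbatim):
«continuum YM on T⁴ ⇐ BetaPertH ∧ nine spine estimates (0/9 proved); BetaPertH ⇐ (D1) ∧ (D4) ∧ CAP+tail; G-an2-4 gates asym, D1 and NE2/3/4.»  0 `def`, 0 cited facts,
0 `def … : Prop`, 0 sorry.  NO estimate of Bałaban's; CONDITIONAL on `hCT` (part 2's END, itself conditional on the CT-4c atom ENDs until they land); it is hSdev for
the cubic-WILSON sector `wilsonSecAt` of the COMB family only — NOT (hSall) of the full `SrecAt` (the born sectors' rate halves are the crux team's sockets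
`BornLambdaDriftSup` ∕ `BornBorderDrift…`; the S-row junction is part 4 `SrecAtRateOfSectors`), NOT the sym family (CT-5), NOT (CONV-C); 0 wall binders; NEVER
«G-an2-4 closed»; NOT D1, NOT BetaPertH, NOT continuum, NOT Clay.

## What is proved
* §1 (generic `d`) [folklore]: `abs_le_of_locStencil` (a local stencil family is entrywise bounded by its constant), `supBound_sub_of_locStencil`
  (`SupBound (S κ u − S′ κ u) (C + C′)`).
* §2 (`d = 3`, `2 ≤ Lc`, pin `cE = Lc^4`) `weight_succ_eq` ∕ `weight_eq_pow` (the unit weight at the pin), **`supRate_unitS_wilsonSecAt_of_contactRate`** (the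
  one-step sup rate of the unit Wilson tables, every in-block root), **`exists_hSdev_wilsonSec_of_contactRate`** — THE END:
  `hCT ⟹ ∃ cS θS δS, 0 ≤ cS ∧ 0 ≤ θS ∧ θS < 1 ∧ 0 < δS ∧ ∀ rr ∈ box 4 Lc, ∀ k j, LocStencil (unitS_{k+j}(wilsonSecAt_{k+j}) − unitS_k(wilsonSecAt_k)) (cS·θS^k) δS`.
Unit `b2b-balaban-gan24-p1` (row owner G-an2-4, gen 22), 2026-08-21.
-/

noncomputable section

open Finset
open scoped BigOperators
open Literature.MathematicalPhysics.QuantumFieldTheory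
open Literature.MathematicalPhysics.QuantumFieldTheory.Balaban1983to89
open Literature.MathematicalPhysics.QuantumFieldTheory.Balaban1983to89.Beta
open B12Sec2to5 (l1 l1_nonneg)
open ExpKernelCalculus (MKer)
open OneStepResolventKernel (Fib LocStencil)
open StepJetData (wilsonA)
open AffineAveraging (Site box toSite)
open BalabanCompositeJets (respStep)
open Summit.QuantumFields.BalabanUV.Beta.HessKerDressedUnits (unitS)
open Summit.QuantumFields.BalabanUV.Beta.GAN24.CombesThomas (sfStep smStep SupBound)
open Summit.QuantumFields.BalabanUV.Beta.GAN24.Push4 (IsFF)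
open Summit.QuantumFields.BalabanUV.Beta.GAN24.Push4Iter (legChain)
open Summit.QuantumFields.BalabanUV.Beta.GAN24.RespStepBmDecompExact (respStepBmSeq)
open Summit.QuantumFields.BalabanUV.Beta.GAN24.Push3 (push₃ isFF_push₃)
open Summit.QuantumFields.BalabanUV.Beta.GAN24.E3UnitSplit (e3OfS)
open Summit.QuantumFields.BalabanUV.Beta.GAN24.SrecWilsonSector (wilsonSecAt isFF_wilsonA unitS_wilsonSecAt_succ_eq_push₃)
open Summit.QuantumFields.BalabanUV.Beta.GAN24.StencilSlotOfShapes (locStencil_mono')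
open Summit.QuantumFields.BalabanUV.Beta.GAN24.WilsonSectorUndressedRow (e3OfS_smul_eq_push₃)
open Summit.QuantumFields.BalabanUV.Beta.GAN24.WilsonSectorRowHolds (exists_hS0_wilsonSec)
open Summit.QuantumFields.BalabanUV.Beta.GAN24.TaylorRowDWThree (rowDW_three)
open Summit.QuantumFields.BalabanUV.Beta.GAN24.StencilSlotSupRate (locStencilCauchy_of_uniform_supRate)

namespace Summit.QuantumFields.BalabanUV.Beta.GAN24.WilsonSectorRate

/-! ## §1 Sup bounds from local stencil letters (generic `d`) -/

section Generic

variable {d : ℕ}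

/-- [folklore] A local stencil family (rate `δ ≥ 0`, constant `C ≥ 0`) is entrywise bounded by its constant. -/
theorem abs_le_of_locStencil {S : Fin (d + 1) → (Fin (d + 1) → ℤ) → MKer (d + 1) (Fib d)} {C δ : ℝ} (h : LocStencil S C δ) (hδ : 0 ≤ δ) (hC : 0 ≤ C)
    (κ : Fin (d + 1)) (u x y : Fin (d + 1) → ℤ) (a b : Fib d) : |S κ u x y a b| ≤ C := by
  refine (h κ u x y a b).trans ?_
  have h1 : Real.exp (-δ * (l1 (x - u) + l1 (y - u))) ≤ 1 := by
    rw [Real.exp_le_one_iff]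
    have := l1_nonneg (x - u)
    have := l1_nonneg (y - u)
    nlinarith
  calc C * Real.exp (-δ * (l1 (x - u) + l1 (y - u))) ≤ C * 1 := mul_le_mul_of_nonneg_left h1 hC
    _ = C := mul_one C

/-- [folklore] Two local stencil families differ entrywise by at most the sum of their constants. -/
theorem supBound_sub_of_locStencil {S S' : Fin (d + 1) → (Fin (d + 1) → ℤ) → MKer (d + 1) (Fib d)} {C C' δ δ' : ℝ}
    (h : LocStencil S C δ) (h' : LocStencil S' C' δ') (hδ : 0 ≤ δ) (hδ' : 0 ≤ δ') (hC : 0 ≤ C) (hC' : 0 ≤ C')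
    (κ : Fin (d + 1)) (u : Fin (d + 1) → ℤ) : SupBound (S κ u - S' κ u) (C + C') := by
  intro x y a b
  rw [Pi.sub_apply, Pi.sub_apply, Pi.sub_apply, Pi.sub_apply]
  have h1 := abs_le_of_locStencil h hδ hC κ u x y a b
  have h2 := abs_le_of_locStencil h' hδ' hC' κ u x y a b
  have h3 := abs_sub (S κ u x y a b) (S' κ u x y a b)
  linarith

end Generic

/-! ## §2 `d = 3`: the one-step sup rate of the unit Wilson tables and hSdev -/

section Three

variable {Lc : ℕ} [NeZero Lc]

omit [NeZero Lc] in
/-- [folklore] **THE UNIT WEIGHT AT THE PIN, AGAINST ROAD S3's ROW-W WEIGHT**: `cE·(cE·Lc^8)^(k+1) = Lc^4·((Lc^(k+1))^8·(cE·Lc^{4k}))` at `cE = Lc^4`. -/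
theorem weight_succ_eq {cE : ℝ} (hcE : cE = (Lc : ℝ) ^ (3 + 1)) (k : ℕ) :
    cE * (cE * (Lc : ℝ) ^ (2 * (3 + 1))) ^ (k + 1)
      = (Lc : ℝ) ^ (3 + 1) * ((((Lc : ℝ) ^ (k + 1)) ^ (2 * (3 + 1)) * (cE * ((Lc : ℝ) ^ (3 + 1)) ^ k))) := by
  subst hcE; ring

omit [NeZero Lc] in
/-- [folklore] **THE UNIT WEIGHT AT THE PIN IN TABLE CURRENCY**: `cE·(cE·Lc^8)^(k+1) = Lc^4·Lc^{12(k+1)}` at `cE = Lc^4`. -/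
theorem weight_eq_pow {cE : ℝ} (hcE : cE = (Lc : ℝ) ^ (3 + 1)) (k : ℕ) :
    cE * (cE * (Lc : ℝ) ^ (2 * (3 + 1))) ^ (k + 1) = (Lc : ℝ) ^ (3 + 1) * (Lc : ℝ) ^ (12 * (k + 1)) := by
  subst hcE; ring

/-- NOT IN PRINT; OUR BOOKKEEPING.  **THE ONE-STEP SUP-NORM RATE OF THE UNIT WILSON TABLES** (`d = 3`, `2 ≤ Lc`, pin `cE = Lc^4`), CONDITIONAL on the contact-term rate
`hCT` (part 2's `ContactCauchyAssembly.exists_contact_supRate_of_atoms`, exact shape): there are `c ≥ 0` and `ρ ∈ [1∕2, 1)` with, for every in-block root `rr`, every `n`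
and every coarse bond `(κ, u)`, `SupBound (U (n+1) κ u − U n κ u) (c·ρ^n)`, `U n = unitS (sfStep Lc n) (smStep 3 Lc n) (wilsonSecAt Lc (toSite rr) cE n)`.
Steps `n ≥ 2`: road S3's `rowDW_three` (undressed legs, `push₃` currency by `e3OfS_smul_eq_push₃`, weight `Lc^4 ×` the row-W weight) + `hCT` (`Lc^4 ×` table currency);
steps `n = 0, 1`: the uniform letter hS0 (`2·Cs ≤ (2Cs∕ρ²)·ρ^n`). -/
theorem supRate_unitS_wilsonSecAt_of_contactRate (hLc : 2 ≤ Lc) {cE : ℝ} (hcE : cE = (Lc : ℝ) ^ (3 + 1))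
    (hCT : ∃ K ϑ : ℝ, 0 ≤ K ∧ 0 ≤ ϑ ∧ ϑ < 1 ∧ ∀ (rr : Fin (3 + 1) → ℕ), rr ∈ box (3 + 1) Lc →
      ∀ (k : ℕ) (κ₁ : Fin (3 + 1)) (u' x' z' : Site (3 + 1)) (α β : Fin (3 + 1)),
        |(Lc : ℝ) ^ (12 * (k + 2)) *
            (push₃ (legChain (respStepBmSeq (d := 3) (toSite rr) Lc) 0 (k + 1)) (legChain (respStepBmSeq (d := 3) (toSite rr) Lc) 0 (k + 1))
                (legChain (respStepBmSeq (d := 3) (toSite rr) Lc) 0 (k + 1)) (wilsonA 3) κ₁ u' x' z' (Sum.inl α) (Sum.inl β)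
              - push₃ (respStep (d := 3) 1 (Lc ^ (k + 2))) (respStep (d := 3) 1 (Lc ^ (k + 2))) (respStep (d := 3) 1 (Lc ^ (k + 2)))
                (wilsonA 3) κ₁ u' x' z' (Sum.inl α) (Sum.inl β))
          - (Lc : ℝ) ^ (12 * (k + 1)) *
            (push₃ (legChain (respStepBmSeq (d := 3) (toSite rr) Lc) 0 k) (legChain (respStepBmSeq (d := 3) (toSite rr) Lc) 0 k)
                (legChain (respStepBmSeq (d := 3) (toSite rr) Lc) 0 k) (wilsonA 3) κ₁ u' x' z' (Sum.inl α) (Sum.inl β)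
              - push₃ (respStep (d := 3) 1 (Lc ^ (k + 1))) (respStep (d := 3) 1 (Lc ^ (k + 1))) (respStep (d := 3) 1 (Lc ^ (k + 1)))
                (wilsonA 3) κ₁ u' x' z' (Sum.inl α) (Sum.inl β))|
          ≤ K * ϑ ^ k) :
    ∃ c ρ : ℝ, 0 ≤ c ∧ (1 / 2 : ℝ) ≤ ρ ∧ ρ < 1 ∧ ∀ (rr : Fin (3 + 1) → ℕ), rr ∈ box (3 + 1) Lc →
      ∀ (n : ℕ) (κ : Fin (3 + 1)) (u : Site (3 + 1)),
        SupBound (unitS (sfStep Lc (n + 1)) (smStep 3 Lc (n + 1)) (wilsonSecAt Lc (toSite rr) cE (n + 1)) κ u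
          - unitS (sfStep Lc n) (smStep 3 Lc n) (wilsonSecAt Lc (toSite rr) cE n) κ u) (c * ρ ^ n) := by
  have hL : (0 : ℝ) < (Lc : ℝ) := by exact_mod_cast Nat.pos_of_ne_zero (NeZero.ne Lc)
  obtain ⟨Cs, δS, hδS, hS0⟩ := exists_hS0_wilsonSec (Lc := Lc) hLc hcE
  obtain ⟨eW, θ, hθ0, hθ1, hDW⟩ := rowDW_three (Lc := Lc) hLc cE
  obtain ⟨K, ϑ, hK, hϑ0, hϑ1, hC⟩ := hCT
  -- one rate, bounded away from zero
  set ρ : ℝ := max (max θ ϑ) (1 / 2 : ℝ) with hρ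
  have hθρ : θ ≤ ρ := (le_max_left _ _).trans (le_max_left _ _)
  have hϑρ : ϑ ≤ ρ := (le_max_right _ _).trans (le_max_left _ _)
  have hρh : (1 / 2 : ℝ) ≤ ρ := le_max_right _ _
  have hρ0 : 0 < ρ := lt_of_lt_of_le (by norm_num) hρh
  have hρ1 : ρ < 1 := max_lt (max_lt hθ1 hϑ1) (by norm_num)
  have hρle1 : ρ ≤ 1 := hρ1.le
  set Cs' : ℝ := max Cs 0 with hCs'
  have hCs'0 : 0 ≤ Cs' := le_max_right _ _
  set c : ℝ := 2 * Cs' / ρ ^ 2 + (Lc : ℝ) ^ (3 + 1) * (|eW| + K) / ρ with hc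
  have hc0 : 0 ≤ c := by positivity
  refine ⟨c, ρ, hc0, hρh, hρ1, fun rr hrr n κ u => ?_⟩
  have hS0' : ∀ j : ℕ, LocStencil (unitS (sfStep Lc j) (smStep 3 Lc j) (wilsonSecAt Lc (toSite rr) cE j)) Cs' δS :=
    fun j => locStencil_mono' (hS0 rr hrr j) (le_max_left _ _) le_rfl
  rcases Nat.lt_or_ge n 2 with hn | hn
  · -- the steps `(1,0)` and `(2,1)`: the uniform letter
    have hsup := supBound_sub_of_locStencil (hS0' (n + 1)) (hS0' n) hδS.le hδS.le hCs'0 hCs'0 κ u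
    intro x y a b
    refine (hsup x y a b).trans ?_
    have hρn : ρ ^ 2 ≤ ρ ^ n := pow_le_pow_of_le_one hρ0.le hρle1 (by omega)
    have hρ20 : 0 < ρ ^ 2 := pow_pos hρ0 2
    calc Cs' + Cs' = (2 * Cs' / ρ ^ 2) * ρ ^ 2 := by field_simp; ring
      _ ≤ (2 * Cs' / ρ ^ 2) * ρ ^ n := mul_le_mul_of_nonneg_left hρn (by positivity)
      _ ≤ c * ρ ^ n := mul_le_mul_of_nonneg_right (by rw [hc]; exact le_add_of_nonneg_right (by positivity)) (pow_nonneg hρ0.le n)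
  · -- the steps `n = m + 2 ≥ 2`: road S3's undressed difference row + the contact-term rate
    obtain ⟨m, rfl⟩ : ∃ m, n = m + 2 := ⟨n - 2, by omega⟩
    have h3 := unitS_wilsonSecAt_succ_eq_push₃ (d := 3) hrr cE (m + 2)
    have h2 := unitS_wilsonSecAt_succ_eq_push₃ (d := 3) hrr cE (m + 1)
    rw [show m + 2 + 1 = m + 3 from rfl] at h3 ⊢
    rw [show m + 1 + 1 = m + 2 from rfl] at h2
    rw [h3, h2]
    intro x z a b
    simp only [Pi.sub_apply, Pi.smul_apply, smul_eq_mul]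
    -- the weights at the pin
    have hw3 := weight_succ_eq (Lc := Lc) hcE (m + 2)
    have hw2 := weight_succ_eq (Lc := Lc) hcE (m + 1)
    have hw3' := weight_eq_pow (Lc := Lc) hcE (m + 2)
    have hw2' := weight_eq_pow (Lc := Lc) hcE (m + 1)
    rw [show m + 2 + 1 = m + 3 from rfl] at hw3 hw3'
    rw [show m + 1 + 1 = m + 2 from rfl] at hw2 hw2'
    -- the target constant
    have hρm0 : 0 ≤ ρ ^ (m + 1) := pow_nonneg hρ0.le _
    have hgoal : (Lc : ℝ) ^ (3 + 1) * (|eW| * θ ^ (m + 1) + K * ϑ ^ (m + 1)) ≤ c * ρ ^ (m + 2) := by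
      have e1 : θ ^ (m + 1) ≤ ρ ^ (m + 1) := pow_le_pow_left₀ hθ0 hθρ _
      have e2 : ϑ ^ (m + 1) ≤ ρ ^ (m + 1) := pow_le_pow_left₀ hϑ0 hϑρ _
      calc (Lc : ℝ) ^ (3 + 1) * (|eW| * θ ^ (m + 1) + K * ϑ ^ (m + 1)) ≤ (Lc : ℝ) ^ (3 + 1) * ((|eW| + K) * ρ ^ (m + 1)) := by
            refine mul_le_mul_of_nonneg_left ?_ (by positivity)
            nlinarith [abs_nonneg eW, hK]
        _ = ((Lc : ℝ) ^ (3 + 1) * (|eW| + K) / ρ) * ρ ^ (m + 2) := by field_simp; ring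
        _ ≤ c * ρ ^ (m + 2) :=
            mul_le_mul_of_nonneg_right (by rw [hc]; exact le_add_of_nonneg_left (by positivity)) (pow_nonneg hρ0.le _)
    rcases b with β | ν
    · rcases a with α | μ
      · -- ff entry: undressed difference + contact difference
        set PT3 := push₃ (legChain (respStepBmSeq (d := 3) (toSite rr) Lc) 0 (m + 2)) (legChain (respStepBmSeq (d := 3) (toSite rr) Lc) 0 (m + 2))
          (legChain (respStepBmSeq (d := 3) (toSite rr) Lc) 0 (m + 2)) (wilsonA 3) κ u x z (Sum.inl α) (Sum.inl β) with hPT3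
        set PT2 := push₃ (legChain (respStepBmSeq (d := 3) (toSite rr) Lc) 0 (m + 1)) (legChain (respStepBmSeq (d := 3) (toSite rr) Lc) 0 (m + 1))
          (legChain (respStepBmSeq (d := 3) (toSite rr) Lc) 0 (m + 1)) (wilsonA 3) κ u x z (Sum.inl α) (Sum.inl β) with hPT2
        set PB3 := push₃ (respStep (d := 3) 1 (Lc ^ (m + 3))) (respStep (d := 3) 1 (Lc ^ (m + 3))) (respStep (d := 3) 1 (Lc ^ (m + 3)))
          (wilsonA 3) κ u x z (Sum.inl α) (Sum.inl β) with hPB3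
        set PB2 := push₃ (respStep (d := 3) 1 (Lc ^ (m + 2))) (respStep (d := 3) 1 (Lc ^ (m + 2))) (respStep (d := 3) 1 (Lc ^ (m + 2)))
          (wilsonA 3) κ u x z (Sum.inl α) (Sum.inl β) with hPB2
        -- the undressed pair: road S3's difference row, read in push currency
        have hX := hDW m κ u x z (Sum.inl α) (Sum.inl β)
        rw [show m + 1 + 1 + 1 = m + 3 from rfl, show m + 1 + 1 = m + 2 from rfl] at hX
        rw [e3OfS_smul_eq_push₃ (N := Lc ^ (m + 3)) (isFF_wilsonA (d := 3)), e3OfS_smul_eq_push₃ (N := Lc ^ (m + 2)) (isFF_wilsonA (d := 3))] at hX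
        simp only [Pi.smul_apply, smul_eq_mul] at hX
        have hU : |cE * (cE * (Lc : ℝ) ^ (2 * (3 + 1))) ^ (m + 3) * PB3 - cE * (cE * (Lc : ℝ) ^ (2 * (3 + 1))) ^ (m + 2) * PB2|
            ≤ (Lc : ℝ) ^ (3 + 1) * (|eW| * θ ^ (m + 1)) := by
          have e : cE * (cE * (Lc : ℝ) ^ (2 * (3 + 1))) ^ (m + 3) * PB3 - cE * (cE * (Lc : ℝ) ^ (2 * (3 + 1))) ^ (m + 2) * PB2
              = (Lc : ℝ) ^ (3 + 1) * ((((Lc : ℝ) ^ (m + 3)) ^ (2 * (3 + 1)) * ((cE * ((Lc : ℝ) ^ (3 + 1)) ^ (m + 2)) * PB3))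
                - (((Lc : ℝ) ^ (m + 2)) ^ (2 * (3 + 1)) * ((cE * ((Lc : ℝ) ^ (3 + 1)) ^ (m + 1)) * PB2))) := by
            rw [hw3, hw2]; ring
          rw [e, abs_mul, abs_of_nonneg (by positivity : (0 : ℝ) ≤ (Lc : ℝ) ^ (3 + 1))]
          refine mul_le_mul_of_nonneg_left (hX.trans ?_) (by positivity)
          exact mul_le_mul_of_nonneg_right (le_abs_self eW) (pow_nonneg hθ0 _)
        -- the contact pair: part 2's rate in table currency
        have hY := hC rr hrr (m + 1) κ u x z α β
        rw [show m + 1 + 2 = m + 3 from rfl, show m + 1 + 1 = m + 2 from rfl] at hY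
        have hV : |cE * (cE * (Lc : ℝ) ^ (2 * (3 + 1))) ^ (m + 3) * (PT3 - PB3) - cE * (cE * (Lc : ℝ) ^ (2 * (3 + 1))) ^ (m + 2) * (PT2 - PB2)|
            ≤ (Lc : ℝ) ^ (3 + 1) * (K * ϑ ^ (m + 1)) := by
          have e : cE * (cE * (Lc : ℝ) ^ (2 * (3 + 1))) ^ (m + 3) * (PT3 - PB3) - cE * (cE * (Lc : ℝ) ^ (2 * (3 + 1))) ^ (m + 2) * (PT2 - PB2)
              = (Lc : ℝ) ^ (3 + 1) * ((Lc : ℝ) ^ (12 * (m + 3)) * (PT3 - PB3) - (Lc : ℝ) ^ (12 * (m + 2)) * (PT2 - PB2)) := by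
            rw [hw3', hw2']; ring
          rw [e, abs_mul, abs_of_nonneg (by positivity : (0 : ℝ) ≤ (Lc : ℝ) ^ (3 + 1))]
          exact mul_le_mul_of_nonneg_left hY (by positivity)
        have esplit : cE * (cE * (Lc : ℝ) ^ (2 * (3 + 1))) ^ (m + 3) * PT3 - cE * (cE * (Lc : ℝ) ^ (2 * (3 + 1))) ^ (m + 2) * PT2
            = (cE * (cE * (Lc : ℝ) ^ (2 * (3 + 1))) ^ (m + 3) * PB3 - cE * (cE * (Lc : ℝ) ^ (2 * (3 + 1))) ^ (m + 2) * PB2)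
              + (cE * (cE * (Lc : ℝ) ^ (2 * (3 + 1))) ^ (m + 3) * (PT3 - PB3) - cE * (cE * (Lc : ℝ) ^ (2 * (3 + 1))) ^ (m + 2) * (PT2 - PB2)) := by
          ring
        rw [esplit]
        refine (abs_add_le _ _).trans ((add_le_add hU hV).trans ?_)
        rw [← mul_add]
        exact hgoal
      · -- a multiplier row index: the pushes vanish
        simp only [Push3.push₃_inr_left, mul_zero, sub_zero, abs_zero]
        positivity
    · simp only [Push3.push₃_inr_right, mul_zero, sub_zero, abs_zero]
      positivity

/-- NOT IN PRINT; OUR PROOF ATTEMPT (the CT-ROUTE's CT-4e for the Wilson sector; [folklore] assembly).  **hSdev FOR THE CUBIC-WILSON SECTOR OF THE RECURSIVE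
COMB FAMILY (E)** (`d = 3`, `2 ≤ Lc`, pin `cE = Lc^4`), CONDITIONAL on the contact-term rate `hCT` (part 2's END shape): `∃ cS θS δS, 0 ≤ cS ∧ 0 ≤ θS ∧ θS < 1 ∧
0 < δS ∧` for EVERY in-block root `rr` and ALL `k j`,
`LocStencil (unitS (sfStep Lc (k+j)) (smStep 3 Lc (k+j)) (wilsonSecAt Lc ρ cE (k+j)) − unitS (sfStep Lc k) (smStep 3 Lc k) (wilsonSecAt Lc ρ cE k)) (cS·θS^k) δS` —
hS0 (`WilsonSectorRowHolds.exists_hS0_wilsonSec`, UNCONDITIONAL) interpolated against the one-step sup rate (`supRate_unitS_wilsonSecAt_of_contactRate`) by road S3's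
`locStencilCauchy_of_uniform_supRate` (`θS = √ρ`, `δS ↦ δS∕2`). -/
theorem exists_hSdev_wilsonSec_of_contactRate (hLc : 2 ≤ Lc) {cE : ℝ} (hcE : cE = (Lc : ℝ) ^ (3 + 1))
    (hCT : ∃ K ϑ : ℝ, 0 ≤ K ∧ 0 ≤ ϑ ∧ ϑ < 1 ∧ ∀ (rr : Fin (3 + 1) → ℕ), rr ∈ box (3 + 1) Lc →
      ∀ (k : ℕ) (κ₁ : Fin (3 + 1)) (u' x' z' : Site (3 + 1)) (α β : Fin (3 + 1)),
        |(Lc : ℝ) ^ (12 * (k + 2)) *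
            (push₃ (legChain (respStepBmSeq (d := 3) (toSite rr) Lc) 0 (k + 1)) (legChain (respStepBmSeq (d := 3) (toSite rr) Lc) 0 (k + 1))
                (legChain (respStepBmSeq (d := 3) (toSite rr) Lc) 0 (k + 1)) (wilsonA 3) κ₁ u' x' z' (Sum.inl α) (Sum.inl β)
              - push₃ (respStep (d := 3) 1 (Lc ^ (k + 2))) (respStep (d := 3) 1 (Lc ^ (k + 2))) (respStep (d := 3) 1 (Lc ^ (k + 2)))
                (wilsonA 3) κ₁ u' x' z' (Sum.inl α) (Sum.inl β))
          - (Lc : ℝ) ^ (12 * (k + 1)) *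
            (push₃ (legChain (respStepBmSeq (d := 3) (toSite rr) Lc) 0 k) (legChain (respStepBmSeq (d := 3) (toSite rr) Lc) 0 k)
                (legChain (respStepBmSeq (d := 3) (toSite rr) Lc) 0 k) (wilsonA 3) κ₁ u' x' z' (Sum.inl α) (Sum.inl β)
              - push₃ (respStep (d := 3) 1 (Lc ^ (k + 1))) (respStep (d := 3) 1 (Lc ^ (k + 1))) (respStep (d := 3) 1 (Lc ^ (k + 1)))
                (wilsonA 3) κ₁ u' x' z' (Sum.inl α) (Sum.inl β))|
          ≤ K * ϑ ^ k) :
    ∃ cS θS δS : ℝ, 0 ≤ cS ∧ 0 ≤ θS ∧ θS < 1 ∧ 0 < δS ∧ ∀ (rr : Fin (3 + 1) → ℕ), rr ∈ box (3 + 1) Lc →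
      ∀ k j : ℕ, LocStencil (unitS (sfStep Lc (k + j)) (smStep 3 Lc (k + j)) (wilsonSecAt Lc (toSite rr) cE (k + j))
        - unitS (sfStep Lc k) (smStep 3 Lc k) (wilsonSecAt Lc (toSite rr) cE k)) (cS * θS ^ k) δS := by
  obtain ⟨Cs, δS, hδS, hS0⟩ := exists_hS0_wilsonSec (Lc := Lc) hLc hcE
  obtain ⟨c, ρ, hc, hρh, hρ1, hR⟩ := supRate_unitS_wilsonSecAt_of_contactRate (Lc := Lc) hLc hcE hCT
  have hρ0 : 0 ≤ ρ := le_trans (by norm_num) hρh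
  set Cs' : ℝ := max Cs 0 with hCs'
  refine ⟨Real.sqrt (2 * (c / (1 - ρ)) * Cs'), Real.sqrt ρ, δS / 2, Real.sqrt_nonneg _, Real.sqrt_nonneg _,
    (Real.sqrt_lt' one_pos).2 (by rwa [one_pow]), by positivity, fun rr hrr k j => ?_⟩
  have hS0' : ∀ n : ℕ, LocStencil (unitS (sfStep Lc n) (smStep 3 Lc n) (wilsonSecAt Lc (toSite rr) cE n)) Cs' δS :=
    fun n => locStencil_mono' (hS0 rr hrr n) (le_max_left _ _) le_rfl
  exact locStencilCauchy_of_uniform_supRate (F := fun n => unitS (sfStep Lc n) (smStep 3 Lc n) (wilsonSecAt Lc (toSite rr) cE n))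
    hS0' (hR rr hrr) hc hρ0 hρ1 k j

end Three

end Summit.QuantumFields.BalabanUV.Beta.GAN24.WilsonSectorRate

end
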